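import Literature.MathematicalPhysics.QuantumLattice.HubbardSliceSymbolSmoothXiThird
import HarnessLib

/-!
# The slice symbol as a function of the band variable: the FOURTH derivative, `‖∂_ξ⁴ Ψ̂‖ ≲ βL²/Λ⁵`

Topic `MathematicalPhysics/QuantumLattice`; continues `HubbardSliceSymbolSmoothXiThird` (cell gate-hubbard-kl; KL located risk «(b)-Wt@j≥1»,
cure (c-D)), which differentiates the single-scale symbol `Ψ̂_ω(ξ) = W(ξ)·R(ξ)`, `W = χ₂((ξ²+ω²)/Λ²) − χ₂((ξ²+ω²)/Λ′²)`, `R = c/(−i(ω+θ)+ξ)`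
THREE times (`‖Ψ̂‴‖ ≤ (64B₃+480B₂+1728B₁+1536)c/Λ⁴`).  The flow-piece telescoping of the weighted slice propagators at a framed band
(Benfatto–Giuliani–Mastropietro 2006, §3 (3.2)–(3.8)) bounds the INCREMENT pieces `Ψ̂(e_{<m} − Kₘ) − Ψ̂(e_{<m})` at single-direction third
differences by the mean value inequality in `ξ` applied to `Ψ̂‴` — one order above the bare piece, exactly as the ultraviolet increment amplitude
`HubbardUVBandPieces.uvIncrQ k` reads `(k+2)!·(4/Λ)^{k+1}` — hence the fourth derivative here ((2.36aa): each derivative costs `Λ⁻¹`):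

* §1 `hasDerivAt_deriv_deriv_deriv_salmhoferCutoff`, `deriv4_salmhoferCutoff_eq_zero_of_lt/_gt`, `exists_deriv4_bound_salmhoferCutoff`;
* §2 `sliceWeightFnD4`, **`hasDerivAt_sliceWeightFnD3`**, `abs_deriv4_term_le`, **`abs_sliceWeightFnD4_le`** (`|W⁗| ≤ (32B₄ + 96B₃ + 24B₂)/Λ⁴`),
  `sliceWeightFnD4_eq_zero_of_not_mem`;
* §3 `resolventFnXiD4 = 24c/(−i(ω+θ)+ξ)⁵`, **`hasDerivAt_resolventFnXiD3`**, `norm_resolventFnXiD4`;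
* §4 `sliceSymbolFnXiD4 = W⁗R + 4W‴R′ + 6W″R″ + 4W′R‴ + WR⁗`, **`hasDerivAt_sliceSymbolFnXiD3`** (everywhere), and
  **`norm_sliceSymbolFnXiD4_le`**: `‖Ψ̂⁗‖ ≤ (128B₄ + 1408B₃ + 7776B₂ + 27648B₁ + 24576)·c/Λ⁵` (`c ≥ 0`, `0 < Λ ≤ Λ′`, `|θ| ≤ Λ/4`);
  `norm_sliceSymbolFnXiD3_sub_le` — the band increment of `Ψ̂‴`: `‖Ψ̂‴(ξ + w) − Ψ̂‴(ξ)‖ ≤ (…)·c/Λ⁵·|w|`.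

Everything is proved; the three functions `sliceWeightFnD4`, `resolventFnXiD4`, `sliceSymbolFnXiD4` are the only definitions; no named facts.

## Sources

G. Benfatto, A. Giuliani, V. Mastropietro, Ann. Henri Poincaré 7 (2006) 809–898, (2.36aa), (2.50), (2.52), §3 (3.2)–(3.8)
(`BenfattoGiulianiMastropietro2006`); M. Salmhofer, *Renormalization* (1999), §4.2.5 (4.70)–(4.71) (`Salmhofer1999`).
-/

noncomputable section

namespace Literature.MathematicalPhysics.QuantumLattice

open Literature.Probability.LatticeModels Set Complex

/-! ### §1 The fourth derivative of Salmhofer's cutoff -/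

/-- `χ₂‴` is differentiable with derivative `χ₂⁗`. [cite: Salmhofer1999, §4.2.5 (4.71)] -/
theorem hasDerivAt_deriv_deriv_deriv_salmhoferCutoff (x : ℝ) :
    HasDerivAt (deriv (deriv (deriv salmhoferCutoff))) (deriv (deriv (deriv (deriv salmhoferCutoff))) x) x := by
  have h4 : ContDiff ℝ 4 salmhoferCutoff := contDiff_salmhoferCutoff
  have h3 : ContDiff ℝ 3 (deriv salmhoferCutoff) := by
    rw [show (4 : WithTop ℕ∞) = 3 + 1 by norm_num] at h4
    exact (contDiff_succ_iff_deriv.1 h4).2.2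
  have h2 : ContDiff ℝ 2 (deriv (deriv salmhoferCutoff)) := by
    rw [show (3 : WithTop ℕ∞) = 2 + 1 by norm_num] at h3
    exact (contDiff_succ_iff_deriv.1 h3).2.2
  have h1 : ContDiff ℝ 1 (deriv (deriv (deriv salmhoferCutoff))) := by
    rw [show (2 : WithTop ℕ∞) = 1 + 1 by norm_num] at h2
    exact (contDiff_succ_iff_deriv.1 h2).2.2
  exact (h1.differentiable one_ne_zero x).hasDerivAt

/-- `χ₂⁗ = 0` below `¼`. [cite: Salmhofer1999, §4.2.5 (4.71)] -/
theorem deriv4_salmhoferCutoff_eq_zero_of_lt {x : ℝ} (hx : x < 1 / 4) :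
    deriv (deriv (deriv (deriv salmhoferCutoff))) x = 0 := by
  have hev : deriv (deriv (deriv salmhoferCutoff)) =ᶠ[nhds x] fun _ => (0 : ℝ) := by
    filter_upwards [Iio_mem_nhds hx] with y hy
    exact deriv_deriv_deriv_salmhoferCutoff_eq_zero_of_lt hy
  rw [hev.deriv_eq, deriv_const]

/-- `χ₂⁗ = 0` above `1`. [cite: Salmhofer1999, §4.2.5 (4.71)] -/
theorem deriv4_salmhoferCutoff_eq_zero_of_gt {x : ℝ} (hx : 1 < x) :
    deriv (deriv (deriv (deriv salmhoferCutoff))) x = 0 := by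
  have hev : deriv (deriv (deriv salmhoferCutoff)) =ᶠ[nhds x] fun _ => (0 : ℝ) := by
    filter_upwards [Ioi_mem_nhds hx] with y hy
    exact deriv_deriv_deriv_salmhoferCutoff_eq_zero_of_gt hy
  rw [hev.deriv_eq, deriv_const]

/-- **A global bound for the fourth derivative of Salmhofer's cutoff**: `∃ B₄ ≥ 0, |χ₂⁗| ≤ B₄`. [cite: Salmhofer1999, §4.2.5 (4.71)] -/
theorem exists_deriv4_bound_salmhoferCutoff :
    ∃ B₄ : ℝ, 0 ≤ B₄ ∧ ∀ x, |deriv (deriv (deriv (deriv salmhoferCutoff))) x| ≤ B₄ := by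
  have h5 : ContDiff ℝ 5 salmhoferCutoff := contDiff_salmhoferCutoff
  have h4 : ContDiff ℝ 4 (deriv salmhoferCutoff) := by
    rw [show (5 : WithTop ℕ∞) = 4 + 1 by norm_num] at h5
    exact (contDiff_succ_iff_deriv.1 h5).2.2
  have h3 : ContDiff ℝ 3 (deriv (deriv salmhoferCutoff)) := by
    rw [show (4 : WithTop ℕ∞) = 3 + 1 by norm_num] at h4
    exact (contDiff_succ_iff_deriv.1 h4).2.2
  have h2 : ContDiff ℝ 2 (deriv (deriv (deriv salmhoferCutoff))) := by
    rw [show (3 : WithTop ℕ∞) = 2 + 1 by norm_num] at h3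
    exact (contDiff_succ_iff_deriv.1 h3).2.2
  have h1 : ContDiff ℝ 1 (deriv (deriv (deriv (deriv salmhoferCutoff)))) := by
    rw [show (2 : WithTop ℕ∞) = 1 + 1 by norm_num] at h2
    exact (contDiff_succ_iff_deriv.1 h2).2.2
  have hc4 : Continuous (deriv (deriv (deriv (deriv salmhoferCutoff)))) := h1.continuous
  obtain ⟨C₄, hC₄⟩ := (isCompact_Icc : IsCompact (Icc (0 : ℝ) 2)).exists_bound_of_continuousOn hc4.continuousOn
  have hout : ∀ x : ℝ, x ∉ Icc (0 : ℝ) 2 → deriv (deriv (deriv (deriv salmhoferCutoff))) x = 0 := by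
    intro x hx
    rw [Set.mem_Icc, not_and_or, not_le, not_le] at hx
    rcases hx with hx | hx
    · exact deriv4_salmhoferCutoff_eq_zero_of_lt (by linarith)
    · exact deriv4_salmhoferCutoff_eq_zero_of_gt (by linarith)
  refine ⟨max C₄ 0, le_max_right _ _, fun x => ?_⟩
  by_cases hx : x ∈ Icc (0 : ℝ) 2
  · exact (Real.norm_eq_abs _ ▸ hC₄ x hx).trans (le_max_left _ _)
  · rw [hout x hx, abs_zero]; exact le_max_right _ _

/-! ### §2 The fourth derivative of the slice weight -/

/-- The fourth derivative of the slice weight: per cutoff term `χ₂⁗(u)s⁴ + 6χ₂‴(u)s²r + 3χ₂″(u)r²`, `u = (ω²+ξ²)/Λ²`, `s = 2ω/Λ²`, `r = 2/Λ²`.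
[cite: Salmhofer1999, §4.2.5 (4.70)] -/
def sliceWeightFnD4 (Λ Λ' ξ ω : ℝ) : ℝ :=
  (deriv (deriv (deriv (deriv salmhoferCutoff))) ((ω ^ 2 + ξ ^ 2) / Λ ^ 2) * (2 * ω / Λ ^ 2) * (2 * ω / Λ ^ 2) * (2 * ω / Λ ^ 2) *
        (2 * ω / Λ ^ 2) +
      6 * (deriv (deriv (deriv salmhoferCutoff)) ((ω ^ 2 + ξ ^ 2) / Λ ^ 2) * (2 * ω / Λ ^ 2) * (2 * ω / Λ ^ 2) * (2 / Λ ^ 2)) +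
      3 * (deriv (deriv salmhoferCutoff) ((ω ^ 2 + ξ ^ 2) / Λ ^ 2) * (2 / Λ ^ 2) * (2 / Λ ^ 2))) -
    (deriv (deriv (deriv (deriv salmhoferCutoff))) ((ω ^ 2 + ξ ^ 2) / Λ' ^ 2) * (2 * ω / Λ' ^ 2) * (2 * ω / Λ' ^ 2) * (2 * ω / Λ' ^ 2) *
        (2 * ω / Λ' ^ 2) +
      6 * (deriv (deriv (deriv salmhoferCutoff)) ((ω ^ 2 + ξ ^ 2) / Λ' ^ 2) * (2 * ω / Λ' ^ 2) * (2 * ω / Λ' ^ 2) * (2 / Λ' ^ 2)) +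
      3 * (deriv (deriv salmhoferCutoff) ((ω ^ 2 + ξ ^ 2) / Λ' ^ 2) * (2 / Λ' ^ 2) * (2 / Λ' ^ 2)))

/-- One cutoff term of `W‴` has derivative the corresponding term of `W⁗`. [cite: Salmhofer1999, §4.2.5 (4.70)] -/
theorem hasDerivAt_deriv3_term (Λ ξ ω : ℝ) :
    HasDerivAt (fun t : ℝ => deriv (deriv (deriv salmhoferCutoff)) ((t ^ 2 + ξ ^ 2) / Λ ^ 2) * (2 * t / Λ ^ 2) * (2 * t / Λ ^ 2) *
          (2 * t / Λ ^ 2) +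
        3 * (deriv (deriv salmhoferCutoff) ((t ^ 2 + ξ ^ 2) / Λ ^ 2) * (2 * t / Λ ^ 2) * (2 / Λ ^ 2)))
      (deriv (deriv (deriv (deriv salmhoferCutoff))) ((ω ^ 2 + ξ ^ 2) / Λ ^ 2) * (2 * ω / Λ ^ 2) * (2 * ω / Λ ^ 2) * (2 * ω / Λ ^ 2) *
          (2 * ω / Λ ^ 2) +
        6 * (deriv (deriv (deriv salmhoferCutoff)) ((ω ^ 2 + ξ ^ 2) / Λ ^ 2) * (2 * ω / Λ ^ 2) * (2 * ω / Λ ^ 2) * (2 / Λ ^ 2)) +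
        3 * (deriv (deriv salmhoferCutoff) ((ω ^ 2 + ξ ^ 2) / Λ ^ 2) * (2 / Λ ^ 2) * (2 / Λ ^ 2))) ω := by
  have hlin : HasDerivAt (fun t : ℝ => 2 * t / Λ ^ 2) (2 / Λ ^ 2) ω := by
    simpa using ((hasDerivAt_id ω).const_mul 2).div_const (Λ ^ 2)
  have hA : HasDerivAt (fun t : ℝ => deriv (deriv (deriv salmhoferCutoff)) ((t ^ 2 + ξ ^ 2) / Λ ^ 2))
      (deriv (deriv (deriv (deriv salmhoferCutoff))) ((ω ^ 2 + ξ ^ 2) / Λ ^ 2) * (2 * ω / Λ ^ 2)) ω :=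
    (hasDerivAt_deriv_deriv_deriv_salmhoferCutoff _).comp ω (hasDerivAt_sqArg Λ ξ ω)
  have hB : HasDerivAt (fun t : ℝ => deriv (deriv salmhoferCutoff) ((t ^ 2 + ξ ^ 2) / Λ ^ 2))
      (deriv (deriv (deriv salmhoferCutoff)) ((ω ^ 2 + ξ ^ 2) / Λ ^ 2) * (2 * ω / Λ ^ 2)) ω :=
    (hasDerivAt_deriv_deriv_salmhoferCutoff _).comp ω (hasDerivAt_sqArg Λ ξ ω)
  refine ((((hA.mul hlin).mul hlin).mul hlin).add (((hB.mul hlin).mul_const (2 / Λ ^ 2)).const_mul 3)).congr_deriv ?_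
  simp only [Pi.mul_apply]
  ring

/-- **`W⁗ = sliceWeightFnD4`.** [cite: Salmhofer1999, §4.2.5 (4.70)] -/
theorem hasDerivAt_sliceWeightFnD3 (Λ Λ' ξ ω : ℝ) :
    HasDerivAt (sliceWeightFnD3 Λ Λ' ξ) (sliceWeightFnD4 Λ Λ' ξ ω) ω := by
  unfold sliceWeightFnD3 sliceWeightFnD4
  exact (hasDerivAt_deriv3_term Λ ξ ω).sub (hasDerivAt_deriv3_term Λ' ξ ω)

section WeightBounds

variable {B₂ B₃ B₄ : ℝ}

/-- The fourth-order chain-rule terms of ONE cutoff: `|χ₂⁗(u)s⁴ + 6χ₂‴(u)s²r + 3χ₂″(u)r²| ≤ (16B₄ + 48B₃ + 12B₂)/Λ⁴`.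
[cite: BenfattoGiulianiMastropietro2006, (2.36aa)] -/
theorem abs_deriv4_term_le (hB₂ : ∀ x, |deriv (deriv salmhoferCutoff) x| ≤ B₂)
    (hB₃ : ∀ x, |deriv (deriv (deriv salmhoferCutoff)) x| ≤ B₃)
    (hB₄ : ∀ x, |deriv (deriv (deriv (deriv salmhoferCutoff))) x| ≤ B₄) {Λ : ℝ} (hΛ : 0 < Λ) (ξ ω : ℝ) :
    |deriv (deriv (deriv (deriv salmhoferCutoff))) ((ω ^ 2 + ξ ^ 2) / Λ ^ 2) * (2 * ω / Λ ^ 2) * (2 * ω / Λ ^ 2) * (2 * ω / Λ ^ 2) *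
          (2 * ω / Λ ^ 2) +
        6 * (deriv (deriv (deriv salmhoferCutoff)) ((ω ^ 2 + ξ ^ 2) / Λ ^ 2) * (2 * ω / Λ ^ 2) * (2 * ω / Λ ^ 2) * (2 / Λ ^ 2)) +
        3 * (deriv (deriv salmhoferCutoff) ((ω ^ 2 + ξ ^ 2) / Λ ^ 2) * (2 / Λ ^ 2) * (2 / Λ ^ 2))| ≤
      (16 * B₄ + 48 * B₃ + 12 * B₂) / Λ ^ 4 := by
  have hB20 : 0 ≤ B₂ := (abs_nonneg _).trans (hB₂ 0)
  have hB30 : 0 ≤ B₃ := (abs_nonneg _).trans (hB₃ 0)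
  have hB40 : 0 ≤ B₄ := (abs_nonneg _).trans (hB₄ 0)
  by_cases hgt : 1 < (ω ^ 2 + ξ ^ 2) / Λ ^ 2
  · rw [deriv4_salmhoferCutoff_eq_zero_of_gt hgt, deriv_deriv_deriv_salmhoferCutoff_eq_zero_of_gt hgt,
      deriv_deriv_salmhoferCutoff_eq_zero_of_gt hgt]
    simp only [zero_mul, mul_zero, add_zero, abs_zero]
    positivity
  · have hω2 : ω ^ 2 ≤ Λ ^ 2 := by
      rw [not_lt, div_le_one (by positivity)] at hgt
      nlinarith [sq_nonneg ξ]
    have hωabs : |ω| ≤ Λ := by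
      obtain ⟨h1, h2⟩ := abs_le_of_sq_le_sq' hω2 hΛ.le
      exact abs_le.2 ⟨h1, h2⟩
    have hs : |2 * ω / Λ ^ 2| ≤ 2 / Λ := by
      rw [abs_div, abs_of_pos (by positivity : (0 : ℝ) < Λ ^ 2), abs_mul, abs_of_pos (by norm_num : (0 : ℝ) < 2),
        div_le_div_iff₀ (by positivity) hΛ]
      nlinarith [abs_nonneg ω]
    have hs0 : 0 ≤ |2 * ω / Λ ^ 2| := abs_nonneg _
    have hr : |2 / Λ ^ 2| = 2 / Λ ^ 2 := abs_of_pos (by positivity)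
    have hfirst : |deriv (deriv (deriv (deriv salmhoferCutoff))) ((ω ^ 2 + ξ ^ 2) / Λ ^ 2) * (2 * ω / Λ ^ 2) * (2 * ω / Λ ^ 2) *
        (2 * ω / Λ ^ 2) * (2 * ω / Λ ^ 2)| ≤ 16 * B₄ / Λ ^ 4 := by
      rw [abs_mul, abs_mul, abs_mul, abs_mul]
      have h4 : |2 * ω / Λ ^ 2| * |2 * ω / Λ ^ 2| * |2 * ω / Λ ^ 2| * |2 * ω / Λ ^ 2| ≤ (2 / Λ) * (2 / Λ) * (2 / Λ) * (2 / Λ) := by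
        have := mul_le_mul hs hs hs0 (by positivity)
        have h3 := mul_le_mul this hs hs0 (by positivity)
        exact mul_le_mul h3 hs hs0 (by positivity)
      calc |deriv (deriv (deriv (deriv salmhoferCutoff))) ((ω ^ 2 + ξ ^ 2) / Λ ^ 2)| * |2 * ω / Λ ^ 2| * |2 * ω / Λ ^ 2| *
            |2 * ω / Λ ^ 2| * |2 * ω / Λ ^ 2|
          = |deriv (deriv (deriv (deriv salmhoferCutoff))) ((ω ^ 2 + ξ ^ 2) / Λ ^ 2)| *
              (|2 * ω / Λ ^ 2| * |2 * ω / Λ ^ 2| * |2 * ω / Λ ^ 2| * |2 * ω / Λ ^ 2|) := by ring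
        _ ≤ B₄ * ((2 / Λ) * (2 / Λ) * (2 / Λ) * (2 / Λ)) := mul_le_mul (hB₄ _) h4 (by positivity) hB40
        _ = 16 * B₄ / Λ ^ 4 := by field_simp; ring
    have hsecond : |6 * (deriv (deriv (deriv salmhoferCutoff)) ((ω ^ 2 + ξ ^ 2) / Λ ^ 2) * (2 * ω / Λ ^ 2) * (2 * ω / Λ ^ 2) *
        (2 / Λ ^ 2))| ≤ 48 * B₃ / Λ ^ 4 := by
      rw [abs_mul, abs_of_pos (by norm_num : (0 : ℝ) < 6), abs_mul, abs_mul, abs_mul, hr]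
      have h2 : |2 * ω / Λ ^ 2| * |2 * ω / Λ ^ 2| ≤ (2 / Λ) * (2 / Λ) := mul_le_mul hs hs hs0 (by positivity)
      calc 6 * (|deriv (deriv (deriv salmhoferCutoff)) ((ω ^ 2 + ξ ^ 2) / Λ ^ 2)| * |2 * ω / Λ ^ 2| * |2 * ω / Λ ^ 2| * (2 / Λ ^ 2))
          = 6 * (|deriv (deriv (deriv salmhoferCutoff)) ((ω ^ 2 + ξ ^ 2) / Λ ^ 2)| * (|2 * ω / Λ ^ 2| * |2 * ω / Λ ^ 2|) *
              (2 / Λ ^ 2)) := by ring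
        _ ≤ 6 * (B₃ * ((2 / Λ) * (2 / Λ)) * (2 / Λ ^ 2)) := by
            refine mul_le_mul_of_nonneg_left (mul_le_mul_of_nonneg_right ?_ (by positivity)) (by norm_num)
            exact mul_le_mul (hB₃ _) h2 (by positivity) hB30
        _ = 48 * B₃ / Λ ^ 4 := by field_simp; ring
    have hthird : |3 * (deriv (deriv salmhoferCutoff) ((ω ^ 2 + ξ ^ 2) / Λ ^ 2) * (2 / Λ ^ 2) * (2 / Λ ^ 2))| ≤ 12 * B₂ / Λ ^ 4 := by
      rw [abs_mul, abs_of_pos (by norm_num : (0 : ℝ) < 3), abs_mul, abs_mul, hr]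
      calc 3 * (|deriv (deriv salmhoferCutoff) ((ω ^ 2 + ξ ^ 2) / Λ ^ 2)| * (2 / Λ ^ 2) * (2 / Λ ^ 2))
          ≤ 3 * (B₂ * (2 / Λ ^ 2) * (2 / Λ ^ 2)) := by
            refine mul_le_mul_of_nonneg_left ?_ (by norm_num)
            exact mul_le_mul_of_nonneg_right (mul_le_mul_of_nonneg_right (hB₂ _) (by positivity)) (by positivity)
        _ = 12 * B₂ / Λ ^ 4 := by field_simp; ring
    calc _ ≤ |deriv (deriv (deriv (deriv salmhoferCutoff))) ((ω ^ 2 + ξ ^ 2) / Λ ^ 2) * (2 * ω / Λ ^ 2) * (2 * ω / Λ ^ 2) *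
            (2 * ω / Λ ^ 2) * (2 * ω / Λ ^ 2) +
          6 * (deriv (deriv (deriv salmhoferCutoff)) ((ω ^ 2 + ξ ^ 2) / Λ ^ 2) * (2 * ω / Λ ^ 2) * (2 * ω / Λ ^ 2) * (2 / Λ ^ 2))| +
          |3 * (deriv (deriv salmhoferCutoff) ((ω ^ 2 + ξ ^ 2) / Λ ^ 2) * (2 / Λ ^ 2) * (2 / Λ ^ 2))| := abs_add_le _ _
      _ ≤ (|deriv (deriv (deriv (deriv salmhoferCutoff))) ((ω ^ 2 + ξ ^ 2) / Λ ^ 2) * (2 * ω / Λ ^ 2) * (2 * ω / Λ ^ 2) *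
            (2 * ω / Λ ^ 2) * (2 * ω / Λ ^ 2)| +
          |6 * (deriv (deriv (deriv salmhoferCutoff)) ((ω ^ 2 + ξ ^ 2) / Λ ^ 2) * (2 * ω / Λ ^ 2) * (2 * ω / Λ ^ 2) * (2 / Λ ^ 2))|) +
          |3 * (deriv (deriv salmhoferCutoff) ((ω ^ 2 + ξ ^ 2) / Λ ^ 2) * (2 / Λ ^ 2) * (2 / Λ ^ 2))| :=
          add_le_add (abs_add_le _ _) le_rfl
      _ ≤ (16 * B₄ / Λ ^ 4 + 48 * B₃ / Λ ^ 4) + 12 * B₂ / Λ ^ 4 := add_le_add (add_le_add hfirst hsecond) hthird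
      _ = (16 * B₄ + 48 * B₃ + 12 * B₂) / Λ ^ 4 := by ring

/-- **`|W⁗| ≤ (32B₄ + 96B₃ + 24B₂)/Λ⁴`** (`0 < Λ ≤ Λ′`). [cite: BenfattoGiulianiMastropietro2006, (2.36aa)] -/
theorem abs_sliceWeightFnD4_le (hB₂ : ∀ x, |deriv (deriv salmhoferCutoff) x| ≤ B₂)
    (hB₃ : ∀ x, |deriv (deriv (deriv salmhoferCutoff)) x| ≤ B₃)
    (hB₄ : ∀ x, |deriv (deriv (deriv (deriv salmhoferCutoff))) x| ≤ B₄) {Λ Λ' : ℝ} (hΛ : 0 < Λ) (hΛΛ' : Λ ≤ Λ') (ξ ω : ℝ) :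
    |sliceWeightFnD4 Λ Λ' ξ ω| ≤ (32 * B₄ + 96 * B₃ + 24 * B₂) / Λ ^ 4 := by
  have hB20 : 0 ≤ B₂ := (abs_nonneg _).trans (hB₂ 0)
  have hB30 : 0 ≤ B₃ := (abs_nonneg _).trans (hB₃ 0)
  have hB40 : 0 ≤ B₄ := (abs_nonneg _).trans (hB₄ 0)
  have hΛ' : 0 < Λ' := hΛ.trans_le hΛΛ'
  unfold sliceWeightFnD4
  refine (abs_sub _ _).trans ?_
  have h1 := abs_deriv4_term_le hB₂ hB₃ hB₄ hΛ ξ ω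
  have h2 := abs_deriv4_term_le hB₂ hB₃ hB₄ hΛ' ξ ω
  have h3 : (16 * B₄ + 48 * B₃ + 12 * B₂) / Λ' ^ 4 ≤ (16 * B₄ + 48 * B₃ + 12 * B₂) / Λ ^ 4 :=
    div_le_div_of_nonneg_left (by positivity) (by positivity) (pow_le_pow_left₀ hΛ.le hΛΛ' 4)
  calc _ ≤ (16 * B₄ + 48 * B₃ + 12 * B₂) / Λ ^ 4 + (16 * B₄ + 48 * B₃ + 12 * B₂) / Λ' ^ 4 := add_le_add h1 h2
    _ ≤ (16 * B₄ + 48 * B₃ + 12 * B₂) / Λ ^ 4 + (16 * B₄ + 48 * B₃ + 12 * B₂) / Λ ^ 4 := by linarith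
    _ = (32 * B₄ + 96 * B₃ + 24 * B₂) / Λ ^ 4 := by ring

end WeightBounds

/-- **Off the closed shell `Λ²/4 ≤ ω²+ξ² ≤ Λ′²` the fourth derivative of the weight vanishes too** (`0 < Λ ≤ Λ′`).
[cite: Salmhofer1999, §4.2.5 (4.71)] -/
theorem sliceWeightFnD4_eq_zero_of_not_mem {Λ Λ' : ℝ} (hΛ : 0 < Λ) (hΛΛ' : Λ ≤ Λ') {ξ ω : ℝ}
    (h : ω ^ 2 + ξ ^ 2 < Λ ^ 2 / 4 ∨ Λ' ^ 2 < ω ^ 2 + ξ ^ 2) : sliceWeightFnD4 Λ Λ' ξ ω = 0 := by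
  have hΛ' : 0 < Λ' := hΛ.trans_le hΛΛ'
  have hΛ2 : Λ ^ 2 ≤ Λ' ^ 2 := pow_le_pow_left₀ hΛ.le hΛΛ' 2
  unfold sliceWeightFnD4
  rcases h with h | h
  · have h1 : (ω ^ 2 + ξ ^ 2) / Λ ^ 2 < 1 / 4 := by rw [div_lt_iff₀ (by positivity)]; linarith
    have h2 : (ω ^ 2 + ξ ^ 2) / Λ' ^ 2 < 1 / 4 := by
      rw [div_lt_iff₀ (by positivity)]; nlinarith [sq_nonneg ω, sq_nonneg ξ]
    simp [deriv_deriv_salmhoferCutoff_eq_zero_of_lt h1, deriv_deriv_salmhoferCutoff_eq_zero_of_lt h2,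
      deriv_deriv_deriv_salmhoferCutoff_eq_zero_of_lt h1, deriv_deriv_deriv_salmhoferCutoff_eq_zero_of_lt h2,
      deriv4_salmhoferCutoff_eq_zero_of_lt h1, deriv4_salmhoferCutoff_eq_zero_of_lt h2]
  · have h1 : 1 < (ω ^ 2 + ξ ^ 2) / Λ ^ 2 := by rw [lt_div_iff₀ (by positivity)]; linarith
    have h2 : 1 < (ω ^ 2 + ξ ^ 2) / Λ' ^ 2 := by rw [lt_div_iff₀ (by positivity)]; linarith
    simp [deriv_deriv_salmhoferCutoff_eq_zero_of_gt h1, deriv_deriv_salmhoferCutoff_eq_zero_of_gt h2,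
      deriv_deriv_deriv_salmhoferCutoff_eq_zero_of_gt h1, deriv_deriv_deriv_salmhoferCutoff_eq_zero_of_gt h2,
      deriv4_salmhoferCutoff_eq_zero_of_gt h1, deriv4_salmhoferCutoff_eq_zero_of_gt h2]

/-! ### §3 The fourth `ξ`-derivative of the resolvent factor -/

/-- `∂_ξ⁴ R = 24c/(−i(ω+θ)+ξ)⁵`. [cite: BenfattoGiulianiMastropietro2006, §2.1 (2.3)] -/
def resolventFnXiD4 (c θ ω ξ : ℝ) : ℂ := 24 * (c : ℂ) / (-I * ((ω + θ : ℝ) : ℂ) + (ξ : ℂ)) ^ 5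

/-- `∂_ξ⁴ R = resolventFnXiD4` off the pole. [cite: BenfattoGiulianiMastropietro2006, §2.1 (2.3)] -/
theorem hasDerivAt_resolventFnXiD3 {c θ ω ξ : ℝ} (h : (-I * ((ω + θ : ℝ) : ℂ) + (ξ : ℂ)) ≠ 0) :
    HasDerivAt (resolventFnXiD3 c θ ω) (resolventFnXiD4 c θ ω ξ) ξ := by
  unfold resolventFnXiD3 resolventFnXiD4
  have h4 : (-I * ((ω + θ : ℝ) : ℂ) + (ξ : ℂ)) ^ 4 ≠ 0 := pow_ne_zero 4 h
  have hcb : HasDerivAt (fun t : ℝ => (-I * ((ω + θ : ℝ) : ℂ) + (t : ℂ)) ^ 4)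
      ((4 : ℕ) * (-I * ((ω + θ : ℝ) : ℂ) + (ξ : ℂ)) ^ (4 - 1) * 1) ξ :=
    (hasDerivAt_shiftDen_xi θ ω ξ).pow 4
  have hinv := ((hasDerivAt_inv h4).comp ξ hcb).const_mul (-6 * (c : ℂ))
  refine (hinv.congr_of_eventuallyEq (Filter.Eventually.of_forall fun t => ?_)).congr_deriv ?_
  · simp only [Function.comp, div_eq_mul_inv]
  · set a : ℂ := -I * ((ω + θ : ℝ) : ℂ) + (ξ : ℂ) with ha
    have h5 : a ^ 5 ≠ 0 := pow_ne_zero 5 h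
    have h8 : (a ^ 4) ^ 2 ≠ 0 := pow_ne_zero 2 h4
    rw [show (4 : ℕ) - 1 = 3 from rfl]
    field_simp
    ring

/-- `‖∂_ξ⁴ R‖ = 24c/|a|⁵`. [cite: BenfattoGiulianiMastropietro2006, §2.1 (2.3)] -/
theorem norm_resolventFnXiD4 {c : ℝ} (hc : 0 ≤ c) (θ ω ξ : ℝ) :
    ‖resolventFnXiD4 c θ ω ξ‖ = 24 * c / ‖-I * ((ω + θ : ℝ) : ℂ) + (ξ : ℂ)‖ ^ 5 := by
  rw [resolventFnXiD4, norm_div, norm_mul, Complex.norm_real, Real.norm_eq_abs, abs_of_nonneg hc, norm_pow]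
  norm_num

/-! ### §4 The fourth `ξ`-derivative of the slice symbol -/

/-- `Ψ̂⁗ = W⁗R + 4W‴R′ + 6W″R″ + 4W′R‴ + WR⁗`. [cite: Salmhofer1999, §4.2.5 (4.70)] -/
def sliceSymbolFnXiD4 (c θ Λ Λ' ω ξ : ℝ) : ℂ :=
  (sliceWeightFnD4 Λ Λ' ω ξ : ℂ) * resolventFnXi c θ ω ξ + 4 * ((sliceWeightFnD3 Λ Λ' ω ξ : ℂ) * resolventFnXiD1 c θ ω ξ) +
    6 * ((sliceWeightFnD2 Λ Λ' ω ξ : ℂ) * resolventFnXiD2 c θ ω ξ) + 4 * ((sliceWeightFnD1 Λ Λ' ω ξ : ℂ) * resolventFnXiD3 c θ ω ξ) +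
    (sliceWeightFn Λ Λ' ω ξ : ℂ) * resolventFnXiD4 c θ ω ξ

section Xi

variable {c θ Λ Λ' ω : ℝ}

/-- **`Ψ̂‴` is differentiable in `ξ` everywhere, with derivative `Ψ̂⁗`.** [cite: BenfattoGiulianiMastropietro2006, (2.36aa)] -/
theorem hasDerivAt_sliceSymbolFnXiD3 (hΛ : 0 < Λ) (hΛΛ' : Λ ≤ Λ') (hθ : |θ| ≤ Λ / 4) (ξ : ℝ) :
    HasDerivAt (sliceSymbolFnXiD3 c θ Λ Λ' ω) (sliceSymbolFnXiD4 c θ Λ Λ' ω ξ) ξ := by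
  by_cases h : Λ ^ 2 / 5 < ξ ^ 2 + ω ^ 2
  · have hne := shiftDen_ne_zero_of_gt_xi hθ h
    unfold sliceSymbolFnXiD3 sliceSymbolFnXiD4
    have hA := (hasDerivAt_sliceWeightFnD3 Λ Λ' ω ξ).ofReal_comp.mul (hasDerivAt_resolventFnXi (c := c) hne)
    have hB := ((hasDerivAt_sliceWeightFnD2 Λ Λ' ω ξ).ofReal_comp.mul (hasDerivAt_resolventFnXiD1 (c := c) hne)).const_mul (3 : ℂ)
    have hC := ((hasDerivAt_sliceWeightFnD1 Λ Λ' ω ξ).ofReal_comp.mul (hasDerivAt_resolventFnXiD2 (c := c) hne)).const_mul (3 : ℂ)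
    have hD := (hasDerivAt_sliceWeightFn Λ Λ' ω ξ).ofReal_comp.mul (hasDerivAt_resolventFnXiD3 (c := c) hne)
    refine (((hA.add hB).add hC).add hD).congr_deriv ?_
    ring
  · have hlt : ξ ^ 2 + ω ^ 2 < Λ ^ 2 / 4 := by linarith [not_lt.1 h, pow_pos hΛ 2]
    have hopen : ∀ᶠ t in nhds ξ, t ^ 2 + ω ^ 2 < Λ ^ 2 / 4 :=
      (continuous_pow 2 |>.add continuous_const).continuousAt.eventually_lt continuousAt_const hlt
    have hev : sliceSymbolFnXiD3 c θ Λ Λ' ω =ᶠ[nhds ξ] fun _ => (0 : ℂ) := by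
      filter_upwards [hopen] with t ht
      obtain ⟨h0, h1, h2⟩ := sliceWeightFn_eq_zero_of_not_mem hΛ hΛΛ' (ξ := ω) (ω := t) (Or.inl ht)
      have h3 := sliceWeightFnD3_eq_zero_of_not_mem hΛ hΛΛ' (ξ := ω) (ω := t) (Or.inl ht)
      rw [sliceSymbolFnXiD3, h0, h1, h2, h3, Complex.ofReal_zero]
      ring
    have hD4 : sliceSymbolFnXiD4 c θ Λ Λ' ω ξ = 0 := by
      obtain ⟨h0, h1, h2⟩ := sliceWeightFn_eq_zero_of_not_mem hΛ hΛΛ' (ξ := ω) (ω := ξ) (Or.inl hlt)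
      have h3 := sliceWeightFnD3_eq_zero_of_not_mem hΛ hΛΛ' (ξ := ω) (ω := ξ) (Or.inl hlt)
      have h4 := sliceWeightFnD4_eq_zero_of_not_mem hΛ hΛΛ' (ξ := ω) (ω := ξ) (Or.inl hlt)
      rw [sliceSymbolFnXiD4, h0, h1, h2, h3, h4, Complex.ofReal_zero]
      ring
    rw [hD4]
    exact (hasDerivAt_const ξ (0 : ℂ)).congr_of_eventuallyEq hev

/-- **`‖Ψ̂⁗‖ ≤ (128B₄ + 1408B₃ + 7776B₂ + 27648B₁ + 24576)·c/Λ⁵`** everywhere (`c ≥ 0`, `0 < Λ ≤ Λ′`, `|θ| ≤ Λ/4`; `B₁, …, B₄` bounds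
of `χ₂′, …, χ₂⁗`). [cite: BenfattoGiulianiMastropietro2006, (2.36aa)] -/
theorem norm_sliceSymbolFnXiD4_le (hΛ : 0 < Λ) (hΛΛ' : Λ ≤ Λ') (hθ : |θ| ≤ Λ / 4) (hc : 0 ≤ c) {B₁ B₂ B₃ B₄ : ℝ}
    (hB₁ : ∀ x, |deriv salmhoferCutoff x| ≤ B₁) (hB₂ : ∀ x, |deriv (deriv salmhoferCutoff) x| ≤ B₂)
    (hB₃ : ∀ x, |deriv (deriv (deriv salmhoferCutoff)) x| ≤ B₃)
    (hB₄ : ∀ x, |deriv (deriv (deriv (deriv salmhoferCutoff))) x| ≤ B₄) (ξ : ℝ) :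
    ‖sliceSymbolFnXiD4 c θ Λ Λ' ω ξ‖ ≤ (128 * B₄ + 1408 * B₃ + 7776 * B₂ + 27648 * B₁ + 24576) * c / Λ ^ 5 := by
  have hB10 : 0 ≤ B₁ := (abs_nonneg _).trans (hB₁ 0)
  have hB20 : 0 ≤ B₂ := (abs_nonneg _).trans (hB₂ 0)
  have hB30 : 0 ≤ B₃ := (abs_nonneg _).trans (hB₃ 0)
  have hB40 : 0 ≤ B₄ := (abs_nonneg _).trans (hB₄ 0)
  by_cases hmem : ξ ^ 2 + ω ^ 2 < Λ ^ 2 / 4 ∨ Λ' ^ 2 < ξ ^ 2 + ω ^ 2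
  · obtain ⟨h0, h1, h2⟩ := sliceWeightFn_eq_zero_of_not_mem hΛ hΛΛ' hmem
    have h3 := sliceWeightFnD3_eq_zero_of_not_mem hΛ hΛΛ' hmem
    have h4 := sliceWeightFnD4_eq_zero_of_not_mem hΛ hΛΛ' hmem
    rw [sliceSymbolFnXiD4, h0, h1, h2, h3, h4, Complex.ofReal_zero]
    simp only [zero_mul, mul_zero, add_zero, norm_zero]
    positivity
  · rw [not_or, not_lt, not_lt] at hmem
    have hden := norm_shiftDen_ge hθ (show Λ ^ 2 / 4 ≤ ω ^ 2 + ξ ^ 2 by linarith [hmem.1])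
    set a := ‖-I * ((ω + θ : ℝ) : ℂ) + (ξ : ℂ)‖ with ha
    have ha0 : 0 < a := lt_of_lt_of_le (by positivity) hden
    have hR : ‖resolventFnXi c θ ω ξ‖ ≤ 4 * c / Λ := by
      rw [norm_resolventFnXi hc, div_le_div_iff₀ ha0 hΛ]; nlinarith
    have hR1 : ‖resolventFnXiD1 c θ ω ξ‖ ≤ 16 * c / Λ ^ 2 := by
      rw [norm_resolventFnXiD1 hc, div_le_div_iff₀ (by positivity) (by positivity)]
      have : Λ ^ 2 ≤ 16 * a ^ 2 := by nlinarith
      nlinarith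
    have hR2 : ‖resolventFnXiD2 c θ ω ξ‖ ≤ 128 * c / Λ ^ 3 := by
      rw [norm_resolventFnXiD2 hc, div_le_div_iff₀ (by positivity) (by positivity)]
      have : Λ ^ 3 ≤ 64 * a ^ 3 := by nlinarith [pow_le_pow_left₀ (by positivity : 0 ≤ Λ / 4) hden 3]
      nlinarith
    have hR3 : ‖resolventFnXiD3 c θ ω ξ‖ ≤ 1536 * c / Λ ^ 4 := by
      rw [norm_resolventFnXiD3 hc, div_le_div_iff₀ (by positivity) (by positivity)]
      have : Λ ^ 4 ≤ 256 * a ^ 4 := by nlinarith [pow_le_pow_left₀ (by positivity : 0 ≤ Λ / 4) hden 4]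
      nlinarith
    have hR4 : ‖resolventFnXiD4 c θ ω ξ‖ ≤ 24576 * c / Λ ^ 5 := by
      rw [norm_resolventFnXiD4 hc, div_le_div_iff₀ (by positivity) (by positivity)]
      have : Λ ^ 5 ≤ 1024 * a ^ 5 := by nlinarith [pow_le_pow_left₀ (by positivity : 0 ≤ Λ / 4) hden 5]
      nlinarith
    have hW : ‖(sliceWeightFn Λ Λ' ω ξ : ℂ)‖ ≤ 1 := by
      rw [Complex.norm_real, Real.norm_eq_abs]; exact abs_sliceWeightFn_le_one Λ Λ' ω ξ
    have hW1 : ‖(sliceWeightFnD1 Λ Λ' ω ξ : ℂ)‖ ≤ 4 * B₁ / Λ := by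
      rw [Complex.norm_real, Real.norm_eq_abs]; exact abs_sliceWeightFnD1_le hB₁ hΛ hΛΛ' ω ξ
    have hW2 : ‖(sliceWeightFnD2 Λ Λ' ω ξ : ℂ)‖ ≤ (8 * B₂ + 4 * B₁) / Λ ^ 2 := by
      rw [Complex.norm_real, Real.norm_eq_abs]; exact abs_sliceWeightFnD2_le hB₁ hB₂ hΛ hΛΛ' ω ξ
    have hW3 : ‖(sliceWeightFnD3 Λ Λ' ω ξ : ℂ)‖ ≤ (16 * B₃ + 24 * B₂) / Λ ^ 3 := by
      rw [Complex.norm_real, Real.norm_eq_abs]; exact abs_sliceWeightFnD3_le hB₂ hB₃ hΛ hΛΛ' ω ξ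
    have hW4 : ‖(sliceWeightFnD4 Λ Λ' ω ξ : ℂ)‖ ≤ (32 * B₄ + 96 * B₃ + 24 * B₂) / Λ ^ 4 := by
      rw [Complex.norm_real, Real.norm_eq_abs]; exact abs_sliceWeightFnD4_le hB₂ hB₃ hB₄ hΛ hΛΛ' ω ξ
    rw [sliceSymbolFnXiD4]
    calc _ ≤ ‖(sliceWeightFnD4 Λ Λ' ω ξ : ℂ) * resolventFnXi c θ ω ξ‖ +
          ‖4 * ((sliceWeightFnD3 Λ Λ' ω ξ : ℂ) * resolventFnXiD1 c θ ω ξ)‖ +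
          ‖6 * ((sliceWeightFnD2 Λ Λ' ω ξ : ℂ) * resolventFnXiD2 c θ ω ξ)‖ +
          ‖4 * ((sliceWeightFnD1 Λ Λ' ω ξ : ℂ) * resolventFnXiD3 c θ ω ξ)‖ +
          ‖(sliceWeightFn Λ Λ' ω ξ : ℂ) * resolventFnXiD4 c θ ω ξ‖ := by
          refine (norm_add_le _ _).trans (add_le_add ((norm_add_le _ _).trans (add_le_add ((norm_add_le _ _).trans
            (add_le_add (norm_add_le _ _) le_rfl)) le_rfl)) le_rfl)
      _ ≤ (32 * B₄ + 96 * B₃ + 24 * B₂) / Λ ^ 4 * (4 * c / Λ) + 4 * ((16 * B₃ + 24 * B₂) / Λ ^ 3 * (16 * c / Λ ^ 2)) +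
          6 * ((8 * B₂ + 4 * B₁) / Λ ^ 2 * (128 * c / Λ ^ 3)) + 4 * (4 * B₁ / Λ * (1536 * c / Λ ^ 4)) +
          1 * (24576 * c / Λ ^ 5) := by
          refine add_le_add (add_le_add (add_le_add (add_le_add ?_ ?_) ?_) ?_) ?_
          · rw [norm_mul]; exact mul_le_mul hW4 hR (norm_nonneg _) (by positivity)
          · rw [norm_mul, norm_mul, Complex.norm_ofNat]
            exact mul_le_mul_of_nonneg_left (mul_le_mul hW3 hR1 (norm_nonneg _) (by positivity)) (by norm_num)
          · rw [norm_mul, norm_mul, Complex.norm_ofNat]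
            exact mul_le_mul_of_nonneg_left (mul_le_mul hW2 hR2 (norm_nonneg _) (by positivity)) (by norm_num)
          · rw [norm_mul, norm_mul, Complex.norm_ofNat]
            exact mul_le_mul_of_nonneg_left (mul_le_mul hW1 hR3 (norm_nonneg _) (by positivity)) (by norm_num)
          · rw [norm_mul]; exact mul_le_mul hW hR4 (norm_nonneg _) zero_le_one
      _ = (128 * B₄ + 1408 * B₃ + 7776 * B₂ + 27648 * B₁ + 24576) * c / Λ ^ 5 := by field_simp; ring

/-- **The band increment of `Ψ̂‴`**: `‖Ψ̂‴(ξ + w) − Ψ̂‴(ξ)‖ ≤ (128B₄ + 1408B₃ + 7776B₂ + 27648B₁ + 24576)·c/Λ⁵ · |w|`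
(mean value inequality on `Ψ̂‴`). [cite: BenfattoGiulianiMastropietro2006, §3 (3.2)] -/
theorem norm_sliceSymbolFnXiD3_sub_le (hΛ : 0 < Λ) (hΛΛ' : Λ ≤ Λ') (hθ : |θ| ≤ Λ / 4) (hc : 0 ≤ c) {B₁ B₂ B₃ B₄ : ℝ}
    (hB₁ : ∀ x, |deriv salmhoferCutoff x| ≤ B₁) (hB₂ : ∀ x, |deriv (deriv salmhoferCutoff) x| ≤ B₂)
    (hB₃ : ∀ x, |deriv (deriv (deriv salmhoferCutoff)) x| ≤ B₃)
    (hB₄ : ∀ x, |deriv (deriv (deriv (deriv salmhoferCutoff))) x| ≤ B₄) (ξ w : ℝ) :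
    ‖sliceSymbolFnXiD3 c θ Λ Λ' ω (ξ + w) - sliceSymbolFnXiD3 c θ Λ Λ' ω ξ‖ ≤
      (128 * B₄ + 1408 * B₃ + 7776 * B₂ + 27648 * B₁ + 24576) * c / Λ ^ 5 * |w| := by
  have h := Convex.norm_image_sub_le_of_norm_hasDerivWithin_le (𝕜 := ℝ) (s := Set.univ)
    (fun x _ => (hasDerivAt_sliceSymbolFnXiD3 (c := c) (ω := ω) hΛ hΛΛ' hθ x).hasDerivWithinAt)
    (fun x _ => norm_sliceSymbolFnXiD4_le hΛ hΛΛ' hθ hc hB₁ hB₂ hB₃ hB₄ x) convex_univ (Set.mem_univ ξ) (Set.mem_univ (ξ + w))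
  simpa [Real.norm_eq_abs] using h

end Xi

end Literature.MathematicalPhysics.QuantumLattice

end
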